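import Summits.QuantumFields.YangMills.Theorems.BalabanLadderIRAbstractBasinRung
import HarnessLib

/-!
# Vacuity threshold of the seed `E(θ) = BasinRung.ColdExitAt θ` (crux `IR`, stmt-QuantumFields-19354)

Negative-lane CALIBRATION of the stub of record `ExitBill24.stub_seed24 : BasinRung.ColdExitAt (1/24)`
(slot `Cruxes/IR/Lines/exit_bill_24.lean`, LEAD `ym-ir-line-ab-p1`, 2026-08-28T05:04Z), by the typed-kill lineage
`ym-19354-disprove-1` (memo `pub/ym-beyond/ym-19354-disprove-1/NOT-REFUTED.md` §23.8):

* `coldDefect_lt_one` — the cold period-doubling defect `δᶜ_β(L) = 1 − Z_β(L³×2⌊L/4⌋)/Z_β(L³×⌊L/4⌋)²` is `< 1` at EVERY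
  coupling `β` (any sign) and every side `L`, because both partition functions are positive Haar integrals;
* `coldExitAt_of_one_le` — hence `ColdExitAt θ` is TRIVIALLY TRUE for every `θ ≥ 1` (witness `β₁ = 0`, `L = 8`): the
  one-box seed carries content only for tolerances `θ < 1`; the registered tolerance `1/24` (and every re-base
  `θ ∈ (0,1)`, e.g. `1/8`) is on the contentful side, where `¬ E(θ)` would be β-cofinal non-purity of every cold
  `4:1` torus of a simply-connected simple group — not a kernel target (NOT-REFUTED §23.8).

HONEST FRAMING: calibration only; nothing here bears on the Yang–Mills mass gap, on `BalabanLadder.IR`, or on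
`E(1/24)` itself. [folklore]
-/

noncomputable section

open Literature.MathematicalPhysics.QuantumFieldTheory
open Summit.QuantumFields.YangMills.Cruxes.IR.ColdPurityBridge (coldDefect)
open Summit.QuantumFields.YangMills.Cruxes.IR.BasinRung (ColdExitAt)

namespace Summit.QuantumFields.YangMills.Cruxes.IR.BasinRung.Negative

section Defect

variable {G : Type} [Group G] [TopologicalSpace G] [IsTopologicalGroup G] [CompactSpace G]
  [MeasurableSpace G] [BorelSpace G] [SecondCountableTopology G] {N : ℕ} {ρ : G →* Matrix (Fin N) (Fin N) ℂ}

/-- **`δᶜ_β(L) < 1` always** (continuous `ρ`, any `β : ℝ`, any `L`): both partition functions are `> 0`. [folklore] -/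
theorem coldDefect_lt_one (hρ : Continuous ρ) (β : ℝ) (L : ℕ) : coldDefect ρ β L < 1 := by
  unfold coldDefect
  have h1 : 0 < wilsonFinTorusPartition ρ β L L L (2 * (L / 4)) := wilsonFinTorusPartition_pos hρ β L L L _
  have h2 : 0 < wilsonFinTorusPartition ρ β L L L (L / 4) := wilsonFinTorusPartition_pos hρ β L L L _
  have h3 : 0 < wilsonFinTorusPartition ρ β L L L (2 * (L / 4)) / wilsonFinTorusPartition ρ β L L L (L / 4) ^ 2 :=
    div_pos h1 (pow_pos h2 2)
  linarith

end Defect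

/-- **Vacuity threshold of the one-box seed**: `ColdExitAt θ` holds trivially for every `θ ≥ 1`
(witness `β₁ = 0`, `L = 8`; uses only `Z > 0`). [folklore] -/
theorem coldExitAt_of_one_le {θ : ℝ} (hθ : 1 ≤ θ) : ColdExitAt θ := by
  intro G _ _ _ _ _hG _hsc
  letI : MeasurableSpace G := borel G
  haveI : BorelSpace G := ⟨rfl⟩
  intro r
  haveI : SecondCountableTopology G :=
    (r.continuous.isClosedEmbedding r.injective).isEmbedding.secondCountableTopology
  exact ⟨0, fun β _ => ⟨8, le_rfl, (coldDefect_lt_one r.continuous β 8).le.trans hθ⟩⟩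

end Summit.QuantumFields.YangMills.Cruxes.IR.BasinRung.Negative

end
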